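import Summits.CriticalPhenomena.PercolationContinuityZ3.Theorems.PercNearOneGluingNoHeavyLowerTailFrontierDecRowsRow44CutVertex
import Summits.CriticalPhenomena.PercolationContinuityZ3.Theorems.PercNearOneGluingNoHeavyLowerTailFrontierDecRowsConeImplied
import Mathlib.Tactic.Linarith
import HarnessLib

/-!
# Frontier dec row 15 `E₃(D[ab|c], D[ac|y], D[b|y])` across a cut vertex isolating the terminal `a`: an exact four-row identity

Support file for crux `stmt-CriticalPhenomena-4575` (four-point decreasing `E₃` frontier; row 15 is one of the four independent open rows),
seat `prim-l12-p6` gen 15; memo `run/shared/lean/prim/prim-l12/FROM-prim-l12-p6-g15-ROW44-CUT-VERTICES.md` §8.2.  No definitions, no named facts, no sorries.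

THEOREM (`sahiE3_row15_nonneg_of_threeOneCut_a`).  If every positive-weight edge avoiding `h` is monochromatic for a colouring with `b, c, y` coloured `true` and
`a` coloured `false`, and row 15 is non-negative at `(h, b, c, y)` (the lone terminal replaced by the cut vertex), then row 15 is non-negative at `(a, b, c, y)`.
PROOF.  With the near-side events `Ebc = {b≁c}`, `Ecy = {c≁y}`, `Eby = {b≁y}`, `Hc = {c ↔ h}`, `Hy = {y ↔ h}` and `ρ = P(h ↔ a on the far side)`, the glued events are
`D[ab|c] = Ebc ∖ (Hc ∧ A)`, `D[ac|y] = Ecy ∖ (Hy ∧ A)`, `D[b|y] = Eby`; on `Ecy` the events `Hc, Hy` are disjoint; independence of the sides gives the exact identity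
(found as an 8-term LP certificate, kit j144974, all multipliers 1)
  **`E₃(row 15 at (a,b,c,y)) = (1−ρ)²·row 43 at (b,c,y,h) + ρ(1−ρ)·[row 19 at (b,h,c,y) + row 19 at (c,h,y,b)] + ρ²·row 15 at (h,b,c,y)`**,
where row 43 `(D[b|c], D[b|y], D[c|y])` (3PT-LB) and row 19 `(D[xh|z], D[x|w], D[z|w])` are kernel theorems for every `n` (`frontier_43_all`, `frontier_19_all`,
`…FrontierDecRowsConeImplied`).  The row-44 analogue is `sahiE3_row44_nonneg_of_threeOneCut` (`…Row44ThreeOneCut`).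
-/

noncomputable section

namespace Summit.CriticalPhenomena.PercolationContinuityZ3.Theorems.FrontierDecRows

open MeasureTheory CovTransferCert E3GroupSepCert
open Literature.Probability.Percolation Literature.Probability.LatticeModels

variable {n : ℕ}

/-- The row-15 lone-`a` identity in real variables (atoms of the near side; `r = P(h ↔ a)`), with the linking equations of the
restricted sets as hypotheses; conclusion = Sahi's functional of the glued row. [this work] -/
theorem row15_threeOneCutA_ineq
    (r bc cy by3 bcHc cyHy bccy bcby cyby all3 p q bcbyHc cybyHy r3 s3 A1 A2 A3 A4 B1 B2 B3 B4 C1 C2 : ℝ)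
    (hr0 : 0 ≤ r) (hr1 : r ≤ 1)
    (hA1 : A1 = all3 - r3) (hA2 : A2 = bc - bcHc) (hA3 : A3 = bccy - p) (hA4 : A4 = bcby - bcbyHc)
    (hB1 : B1 = all3 - s3) (hB2 : B2 = cy - cyHy) (hB3 : B3 = cyby - cybyHy) (hB4 : B4 = bccy - q)
    (hC1 : C1 = all3 - (r3 + s3)) (hC2 : C2 = bccy - (p + q))
    (h43 : 0 ≤ 2 * all3 + bc * by3 * cy - (bc * cyby + by3 * bccy + cy * bcby))
    (h19a : 0 ≤ 2 * A1 + A2 * by3 * cy - (A2 * cyby + by3 * A3 + cy * A4))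
    (h19b : 0 ≤ 2 * B1 + B2 * bc * by3 - (B2 * bcby + bc * B3 + by3 * B4))
    (h15 : 0 ≤ 2 * C1 + A2 * B2 * by3 - (A2 * B3 + B2 * A4 + by3 * C2)) :
    0 ≤ 2 * (all3 - (r3 + s3) * r) + (bc - bcHc * r) * (cy - cyHy * r) * by3 -
      ((bc - bcHc * r) * (cyby - cybyHy * r) + (cy - cyHy * r) * (bcby - bcbyHc * r) + by3 * (bccy - (p + q) * r)) := by
  subst hA1 hA2 hA3 hA4 hB1 hB2 hB3 hB4 hC1 hC2
  have key : 2 * (all3 - (r3 + s3) * r) + (bc - bcHc * r) * (cy - cyHy * r) * by3 -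
      ((bc - bcHc * r) * (cyby - cybyHy * r) + (cy - cyHy * r) * (bcby - bcbyHc * r) + by3 * (bccy - (p + q) * r)) =
      (1 - r) ^ 2 * (2 * all3 + bc * by3 * cy - (bc * cyby + by3 * bccy + cy * bcby)) +
      r * (1 - r) * ((2 * (all3 - r3) + (bc - bcHc) * by3 * cy - ((bc - bcHc) * cyby + by3 * (bccy - p) + cy * (bcby - bcbyHc))) +
        (2 * (all3 - s3) + (cy - cyHy) * bc * by3 - ((cy - cyHy) * bcby + bc * (cyby - cybyHy) + by3 * (bccy - q)))) +
      r ^ 2 * (2 * (all3 - (r3 + s3)) + (bc - bcHc) * (cy - cyHy) * by3 -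
        ((bc - bcHc) * (cyby - cybyHy) + (cy - cyHy) * (bcby - bcbyHc) + by3 * (bccy - (p + q)))) := by
    ring
  rw [key]
  have t1 := mul_nonneg (sq_nonneg (1 - r)) h43
  have t2 := mul_nonneg (mul_nonneg hr0 (sub_nonneg.2 hr1)) (add_nonneg h19a h19b)
  have t3 := mul_nonneg (sq_nonneg r) h15
  linarith

set_option maxHeartbeats 1600000 in
/-- **Row 15 across a cut vertex isolating `a`.**  `b, c, y` coloured `true`, `a` coloured `false`, every positive-weight edge avoiding `h` monochromatic:
row 15 at `(h,b,c,y)` implies row 15 at `(a,b,c,y)` (exact identity with rows 43, 19, 19 and the `ρ`-weights `(1−ρ)², ρ(1−ρ), ρ²`). [this work] -/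
theorem sahiE3_row15_nonneg_of_threeOneCut_a (w : Sym2 (Fin n) → unitInterval) (a b c y h : Fin n) (side : Fin n → Bool)
    (hb : side b = true) (hc : side c = true) (hy : side y = true) (ha : side a = false)
    (hw : ∀ u v : Fin n, u ≠ h → v ≠ h → side u ≠ side v → w s(u, v) = 0)
    (h15 : 0 ≤ sahiE3 (prodBernoulli w) (connEvent (row 15 n (h, b, c, y)).1) (connEvent (row 15 n (h, b, c, y)).2.1)
      (connEvent (row 15 n (h, b, c, y)).2.2)) :
    0 ≤ sahiE3 (prodBernoulli w) (connEvent (row 15 n (a, b, c, y)).1) (connEvent (row 15 n (a, b, c, y)).2.1)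
      (connEvent (row 15 n (a, b, c, y)).2.2) := by
  classical
  have h43 := frontier_43_all w b c y h
  have h19a := frontier_19_all w b h c y
  have h19b := frontier_19_all w c h y b
  have hrow : row 15 n (a, b, c, y) = (sep [a, b] [c], sep [a, c] [y], sep [b] [y]) := rfl
  have hrow' : row 15 n (h, b, c, y) = (sep [h, b] [c], sep [h, c] [y], sep [b] [y]) := rfl
  have hrow43 : row 43 n (b, c, y, h) = (sep [b] [c], sep [b] [y], sep [c] [y]) := rfl
  have hrow19a : row 19 n (b, h, c, y) = (sep [b, h] [c], sep [b] [y], sep [c] [y]) := rfl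
  have hrow19b : row 19 n (c, h, y, b) = (sep [c, h] [y], sep [c] [b], sep [y] [b]) := rfl
  simp only [hrow, connEvent_sep]
  simp only [hrow', connEvent_sep] at h15; simp only [hrow43, connEvent_sep] at h43
  simp only [hrow19a, connEvent_sep] at h19a; simp only [hrow19b, connEvent_sep] at h19b
  set μ := prodBernoulli w with hμ
  have neA : ∀ x, side x = true → x ≠ a := fun x hx e => by rw [e, ha] at hx; exact Bool.false_ne_true hx
  obtain ⟨hab, hca, hya⟩ : b ≠ a ∧ c ≠ a ∧ y ≠ a := ⟨neA b hb, neA c hc, neA y hy⟩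
  set F₁ : Finset (Sym2 (Fin n)) := Finset.univ.filter (fun e => ∀ u ∈ e, side u = true ∨ u = h) with hF₁
  set F₂ : Finset (Sym2 (Fin n)) :=
    Finset.univ.filter (fun e => (∀ u ∈ e, side u = false ∨ u = h) ∧ ¬ ∀ u ∈ e, u = h) with hF₂
  have mem₁ : ∀ e, e ∈ F₁ ↔ ∀ u ∈ e, side u = true ∨ u = h := fun e => by rw [hF₁, Finset.mem_filter]; simp
  have mem₂ : ∀ e, e ∈ F₂ ↔ (∀ u ∈ e, side u = false ∨ u = h) ∧ ¬ ∀ u ∈ e, u = h := fun e => by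
    rw [hF₂, Finset.mem_filter]; simp
  have hdisj : Disjoint F₁ F₂ := by
    rw [Finset.disjoint_left]; intro e h1 h2; rw [mem₁] at h1; rw [mem₂] at h2
    apply h2.2
    intro u hu
    rcases h1 u hu with h1 | h1
    · rcases h2.1 u hu with h2 | h2
      · rw [h1] at h2; exact absurd h2 (by decide)
      · exact h2
    · exact h1
  set D : Finset (Sym2 (Fin n)) := F₁ ∪ F₂ with hD
  have hwD : ∀ e, e ∉ D → w e = 0 := by
    intro e he
    rw [hD, Finset.mem_union, not_or, mem₁, mem₂] at he
    obtain ⟨h1, h2⟩ := he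
    induction e using Sym2.ind with
    | h u v =>
      have key : u ≠ h ∧ v ≠ h ∧ side u ≠ side v := by
        by_cases hu : u = h
        · subst hu
          exfalso
          by_cases hv : v = u
          · exact h1 fun x hx => Or.inr (by rcases Sym2.mem_iff.1 hx with e | e <;> [exact e; exact e.trans hv])
          · cases hsv : side v
            · exact h2 ⟨fun x hx => by rcases Sym2.mem_iff.1 hx with e | e <;> [exact Or.inr e; exact Or.inl (e ▸ hsv)],
                fun hall => hv (hall v (Sym2.mem_iff.2 (Or.inr rfl)))⟩
            · exact h1 fun x hx => by rcases Sym2.mem_iff.1 hx with e | e <;> [exact Or.inr e; exact Or.inl (e ▸ hsv)]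
        · by_cases hv : v = h
          · subst hv
            exfalso
            cases hsu : side u
            · exact h2 ⟨fun x hx => by rcases Sym2.mem_iff.1 hx with e | e <;> [exact Or.inl (e ▸ hsu); exact Or.inr e],
                fun hall => hu (hall u (Sym2.mem_iff.2 (Or.inl rfl)))⟩
            · exact h1 fun x hx => by rcases Sym2.mem_iff.1 hx with e | e <;> [exact Or.inl (e ▸ hsu); exact Or.inr e]
          · refine ⟨hu, hv, fun hse => ?_⟩
            cases hsu : side u
            · exact h2 ⟨fun x hx => by
                  rcases Sym2.mem_iff.1 hx with e | e <;> [exact Or.inl (e ▸ hsu); exact Or.inl (e ▸ (hse ▸ hsu))],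
                fun hall => hu (hall u (Sym2.mem_iff.2 (Or.inl rfl)))⟩
            · exact h1 fun x hx => by
                rcases Sym2.mem_iff.1 hx with e | e <;> [exact Or.inl (e ▸ hsu); exact Or.inl (e ▸ (hse ▸ hsu))]
      exact hw u v key.1 key.2.1 key.2.2
  have hT : ∀ ω : Set (Sym2 (Fin n)), ∀ v u u', (openGraph (ω ∩ ↑F₁)).Adj v u → (openGraph (ω ∩ ↑F₂)).Adj v u' → v = h := by
    intro ω v u u' h1 h2
    rw [openGraph_adj] at h1 h2
    have e1 := (mem₁ _).1 (Finset.mem_coe.1 h1.1.2) v (Sym2.mem_iff.2 (Or.inl rfl))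
    have e2 := ((mem₂ _).1 (Finset.mem_coe.1 h2.1.2)).1 v (Sym2.mem_iff.2 (Or.inl rfl))
    rcases e1 with e1 | e1
    · rcases e2 with e2 | e2
      · rw [e1] at e2; exact absurd e2 (by decide)
      · exact e2
    · exact e1
  have iso₂ : ∀ ω : Set (Sym2 (Fin n)), ∀ x, side x = true → x ≠ h → ∀ u, ¬ (openGraph (ω ∩ ↑F₂)).Adj x u := by
    intro ω x hx hxh u hadj
    rw [openGraph_adj] at hadj
    rcases ((mem₂ _).1 (Finset.mem_coe.1 hadj.1.2)).1 x (Sym2.mem_iff.2 (Or.inl rfl)) with e | e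
    · rw [hx] at e; exact Bool.noConfusion e
    · exact hxh e
  have iso₁ : ∀ ω : Set (Sym2 (Fin n)), ∀ x, side x = false → x ≠ h → ∀ u, ¬ (openGraph (ω ∩ ↑F₁)).Adj x u := by
    intro ω x hx hxh u hadj
    rw [openGraph_adj] at hadj
    rcases (mem₁ _).1 (Finset.mem_coe.1 hadj.1.2) x (Sym2.mem_iff.2 (Or.inl rfl)) with e | e
    · rw [hx] at e; exact Bool.noConfusion e
    · exact hxh e
  have isoH : ∀ ω : Set (Sym2 (Fin n)), h ≠ h → ∀ u, ¬ (openGraph (ω ∩ ↑F₂)).Adj h u := fun ω hh => absurd rfl hh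
  have hsup : ∀ ω : Set (Sym2 (Fin n)), openGraph (ω ∩ ↑D) = openGraph (ω ∩ ↑F₁) ⊔ openGraph (ω ∩ ↑F₂) := by
    intro ω
    rw [hD, Finset.coe_union, Set.inter_union_distrib_left]
    exact SimpleGraph.fromEdgeSet_union _ _
  have pl : ∀ ω : Set (Sym2 (Fin n)), ∀ x z, side x = true → side z = true →
      ((openGraph (ω ∩ ↑D)).Reachable x z ↔ (openGraph (ω ∩ ↑F₁)).Reachable x z) := by
    intro ω x z hx hz; rw [hsup ω]; exact reachable_sup_iff_left (hT ω) (iso₂ ω x hx) (iso₂ ω z hz)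
  have plh : ∀ ω : Set (Sym2 (Fin n)), ∀ x, side x = true →
      ((openGraph (ω ∩ ↑D)).Reachable x h ↔ (openGraph (ω ∩ ↑F₁)).Reachable x h) := by
    intro ω x hx; rw [hsup ω]; exact reachable_sup_iff_left (hT ω) (iso₂ ω x hx) (isoH ω)
  have phl : ∀ ω : Set (Sym2 (Fin n)), ∀ x, side x = true →
      ((openGraph (ω ∩ ↑D)).Reachable h x ↔ (openGraph (ω ∩ ↑F₁)).Reachable h x) := by
    intro ω x hx; rw [SimpleGraph.reachable_comm, plh ω x hx, SimpleGraph.reachable_comm]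
  have pc : ∀ ω : Set (Sym2 (Fin n)), ∀ x, side x = true → x ≠ a →
      ((openGraph (ω ∩ ↑D)).Reachable a x ↔
        (openGraph (ω ∩ ↑F₁)).Reachable x h ∧ (openGraph (ω ∩ ↑F₂)).Reachable h a) := by
    intro ω x hx hxa
    rw [SimpleGraph.reachable_comm, hsup ω]
    exact reachable_sup_iff_cross (hT ω) (iso₂ ω x hx) (iso₁ ω a ha) hxa
  set Ebc : Set (Set (Sym2 (Fin n))) := {ω | ω ∩ ↑F₁ ∈ ((openConn b c)ᶜ : Set (Set (Sym2 (Fin n))))} with hEbc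
  set Ecy : Set (Set (Sym2 (Fin n))) := {ω | ω ∩ ↑F₁ ∈ ((openConn c y)ᶜ : Set (Set (Sym2 (Fin n))))} with hEcy
  set Eby : Set (Set (Sym2 (Fin n))) := {ω | ω ∩ ↑F₁ ∈ ((openConn b y)ᶜ : Set (Set (Sym2 (Fin n))))} with hEby
  set Hc : Set (Set (Sym2 (Fin n))) := {ω | ω ∩ ↑F₁ ∈ (openConn c h : Set (Set (Sym2 (Fin n))))} with hHc
  set Hy : Set (Set (Sym2 (Fin n))) := {ω | ω ∩ ↑F₁ ∈ (openConn y h : Set (Set (Sym2 (Fin n))))} with hHy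
  set EA : Set (Set (Sym2 (Fin n))) := {ω | ω ∩ ↑F₂ ∈ (openConn h a : Set (Set (Sym2 (Fin n))))} with hEA
  set X : Set (Set (Sym2 (Fin n))) := {ω | ∀ x ∈ [a, b], ∀ z ∈ [c], ω ∉ openConn x z} with hX
  set Y : Set (Set (Sym2 (Fin n))) := {ω | ∀ x ∈ [a, c], ∀ z ∈ [y], ω ∉ openConn x z} with hY
  set Z : Set (Set (Sym2 (Fin n))) := {ω | ∀ x ∈ [b], ∀ z ∈ [y], ω ∉ openConn x z} with hZ
  have tX : {ω : Set (Sym2 (Fin n)) | ω ∩ ↑D ∈ X} = Ebc \ ((Ebc ∩ Hc) ∩ EA) := by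
    ext ω
    simp only [hX, hEbc, hHc, hEA, Set.mem_setOf_eq, Set.mem_sdiff, Set.mem_inter_iff, Set.mem_compl_iff, openConn, List.mem_cons,
      List.mem_nil_iff, or_false, forall_eq_or_imp, forall_eq]
    rw [pc ω c hc hca, pl ω b c hb hc]
    tauto
  have tY : {ω : Set (Sym2 (Fin n)) | ω ∩ ↑D ∈ Y} = Ecy \ ((Ecy ∩ Hy) ∩ EA) := by
    ext ω
    simp only [hY, hEcy, hHy, hEA, Set.mem_setOf_eq, Set.mem_sdiff, Set.mem_inter_iff, Set.mem_compl_iff, openConn, List.mem_cons,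
      List.mem_nil_iff, or_false, forall_eq_or_imp, forall_eq]
    rw [pc ω y hy hya, pl ω c y hc hy]
    tauto
  have tZ : {ω : Set (Sym2 (Fin n)) | ω ∩ ↑D ∈ Z} = Eby := by
    ext ω
    simp only [hZ, hEby, Set.mem_setOf_eq, List.mem_singleton, forall_eq, Set.mem_compl_iff, openConn]
    exact not_congr (pl ω b y hb hy)
  have tS : ∀ (x z : Fin n), side x = true → side z = true →
      {ω : Set (Sym2 (Fin n)) | ω ∩ ↑D ∈ {ω : Set (Sym2 (Fin n)) | ∀ p ∈ [x], ∀ q ∈ [z], ω ∉ openConn p q}} =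
        {ω | ω ∩ ↑F₁ ∈ ((openConn x z)ᶜ : Set (Set (Sym2 (Fin n))))} := by
    intro x z hx hz; ext ω
    simp only [Set.mem_setOf_eq, List.mem_singleton, forall_eq, Set.mem_compl_iff, openConn]
    exact not_congr (pl ω x z hx hz)
  have tSh : ∀ (x z : Fin n), side x = true → side z = true →
      {ω : Set (Sym2 (Fin n)) | ω ∩ ↑D ∈ {ω : Set (Sym2 (Fin n)) | ∀ p ∈ [x, h], ∀ q ∈ [z], ω ∉ openConn p q}} =
        {ω | ω ∩ ↑F₁ ∈ ((openConn x z)ᶜ : Set (Set (Sym2 (Fin n))))} ∩ {ω | ω ∩ ↑F₁ ∈ (openConn z h : Set (Set (Sym2 (Fin n))))}ᶜ := by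
    intro x z hx hz; ext ω
    simp only [Set.mem_setOf_eq, Set.mem_inter_iff, Set.mem_compl_iff, openConn, List.mem_cons, List.mem_nil_iff, or_false,
      forall_eq_or_imp, forall_eq]
    rw [pl ω x z hx hz, phl ω z hz, SimpleGraph.reachable_comm (u := h)]
  have eCB : {ω : Set (Sym2 (Fin n)) | ω ∩ ↑F₁ ∈ ((openConn c b)ᶜ : Set (Set (Sym2 (Fin n))))} = Ebc := by
    ext ω; simp only [hEbc, Set.mem_setOf_eq, Set.mem_compl_iff, openConn]; rw [SimpleGraph.reachable_comm]
  have eYB : {ω : Set (Sym2 (Fin n)) | ω ∩ ↑F₁ ∈ ((openConn y b)ᶜ : Set (Set (Sym2 (Fin n))))} = Eby := by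
    ext ω; simp only [hEby, Set.mem_setOf_eq, Set.mem_compl_iff, openConn]; rw [SimpleGraph.reachable_comm]
  have thin : ∀ A : Set (Set (Sym2 (Fin n))), μ.real A = μ.real {ω | ω ∩ ↑D ∈ A} :=
    fun A => real_eq_real_setOf_inter_mem w D hwD A
  have pre_inter : ∀ P Q : Set (Set (Sym2 (Fin n))),
      {ω : Set (Sym2 (Fin n)) | ω ∩ ↑D ∈ P ∩ Q} = {ω | ω ∩ ↑D ∈ P} ∩ {ω | ω ∩ ↑D ∈ Q} := fun P Q => rfl
  have ms : ∀ A : Set (Set (Sym2 (Fin n))), MeasurableSet A := fun A => (Set.toFinite _).measurableSet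
  have detA : DeterminedBy EA (↑F₁ : Set (Sym2 (Fin n)))ᶜ := by
    rw [determinedBy_iff]
    intro ω ω' hω
    have hsub : (↑F₂ : Set (Sym2 (Fin n))) ⊆ (↑F₁ : Set (Sym2 (Fin n)))ᶜ := fun e he he1 =>
      Finset.disjoint_left.1 hdisj (Finset.mem_coe.1 he1) (Finset.mem_coe.1 he)
    have : ω ∩ ↑F₂ = ω' ∩ ↑F₂ := by
      rw [← Set.inter_eq_self_of_subset_right hsub, ← Set.inter_assoc, ← Set.inter_assoc, hω]
    simp only [hEA, Set.mem_setOf_eq, this]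
  have indep : ∀ S : Set (Set (Sym2 (Fin n))), (∀ ω ω' : Set (Sym2 (Fin n)), ω ∩ ↑F₁ = ω' ∩ ↑F₁ → (ω ∈ S ↔ ω' ∈ S)) →
      μ.real (S ∩ EA) = μ.real S * μ.real EA :=
    fun S hS => prodBernoulli_real_inter_of_determinedBy w F₁ ((determinedBy_iff S _).2 hS) detA (ms _) (ms _)
  have sd : ∀ S : Set (Set (Sym2 (Fin n))), (∃ P : Set (Set (Sym2 (Fin n))), S = {ω | ω ∩ ↑F₁ ∈ P}) →
      ∀ ω ω' : Set (Sym2 (Fin n)), ω ∩ ↑F₁ = ω' ∩ ↑F₁ → (ω ∈ S ↔ ω' ∈ S) := by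
    rintro S ⟨P, rfl⟩ ω ω' hω; simp only [Set.mem_setOf_eq, hω]
  have djH : ∀ ω, ω ∈ Ecy → ω ∈ Hc → ω ∈ Hy → False := by
    intro ω h1 h2 h3
    simp only [hEcy, hHc, hHy, Set.mem_setOf_eq, Set.mem_compl_iff, openConn] at h1 h2 h3
    exact h1 (h2.trans h3.symm)
  have mOne : ∀ S H : Set (Set (Sym2 (Fin n))), (∃ P : Set (Set (Sym2 (Fin n))), S ∩ H = {ω | ω ∩ ↑F₁ ∈ P}) →
      μ.real (S \ ((S ∩ H) ∩ EA)) = μ.real S - μ.real (S ∩ H) * μ.real EA := by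
    intro S H hP
    rw [measureReal_sdiff (fun ω hω => hω.1.1) (ms _), indep _ (sd _ hP)]
  have mTwo : ∀ S : Set (Set (Sym2 (Fin n))), S ⊆ Ecy → (∃ P : Set (Set (Sym2 (Fin n))), S ∩ Hc = {ω | ω ∩ ↑F₁ ∈ P}) →
      (∃ P : Set (Set (Sym2 (Fin n))), S ∩ Hy = {ω | ω ∩ ↑F₁ ∈ P}) →
      μ.real (S \ (((S ∩ Hc) ∪ (S ∩ Hy)) ∩ EA)) = μ.real S - (μ.real (S ∩ Hc) + μ.real (S ∩ Hy)) * μ.real EA := by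
    intro S hS hP hQ
    have hd : Disjoint ((S ∩ Hc) ∩ EA) ((S ∩ Hy) ∩ EA) :=
      Set.disjoint_left.2 fun ω h1 h2 => djH ω (hS h1.1.1) h1.1.2 h2.1.2
    rw [Set.union_inter_distrib_right, measureReal_sdiff (fun ω hω => by
      rcases hω with h1 | h2
      · exact h1.1.1
      · exact h2.1.1) (ms _), measureReal_union hd (ms _), indep _ (sd _ hP), indep _ (sd _ hQ)]
    ring
  have eX : μ.real X = μ.real Ebc - μ.real (Ebc ∩ Hc) * μ.real EA := by
    rw [thin, tX]; exact mOne Ebc Hc ⟨(openConn b c)ᶜ ∩ openConn c h, rfl⟩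
  have eY : μ.real Y = μ.real Ecy - μ.real (Ecy ∩ Hy) * μ.real EA := by
    rw [thin, tY]; exact mOne Ecy Hy ⟨(openConn c y)ᶜ ∩ openConn y h, rfl⟩
  have eZ : μ.real Z = μ.real Eby := by rw [thin, tZ]
  have eXZ : μ.real (X ∩ Z) = μ.real (Ebc ∩ Eby) - μ.real (Ebc ∩ Eby ∩ Hc) * μ.real EA := by
    rw [thin, pre_inter, tX, tZ]
    have e : Ebc \ ((Ebc ∩ Hc) ∩ EA) ∩ Eby = (Ebc ∩ Eby) \ (((Ebc ∩ Eby) ∩ Hc) ∩ EA) := by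
      ext ω; simp only [Set.mem_sdiff, Set.mem_inter_iff]; tauto
    rw [e]; exact mOne (Ebc ∩ Eby) Hc ⟨(openConn b c)ᶜ ∩ (openConn b y)ᶜ ∩ openConn c h, rfl⟩
  have eYZ : μ.real (Y ∩ Z) = μ.real (Ecy ∩ Eby) - μ.real (Ecy ∩ Eby ∩ Hy) * μ.real EA := by
    rw [thin, pre_inter, tY, tZ]
    have e : Ecy \ ((Ecy ∩ Hy) ∩ EA) ∩ Eby = (Ecy ∩ Eby) \ (((Ecy ∩ Eby) ∩ Hy) ∩ EA) := by
      ext ω; simp only [Set.mem_sdiff, Set.mem_inter_iff]; tauto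
    rw [e]; exact mOne (Ecy ∩ Eby) Hy ⟨(openConn c y)ᶜ ∩ (openConn b y)ᶜ ∩ openConn y h, rfl⟩
  have eXY : μ.real (X ∩ Y) = μ.real (Ebc ∩ Ecy) - (μ.real (Ebc ∩ Ecy ∩ Hc) + μ.real (Ebc ∩ Ecy ∩ Hy)) * μ.real EA := by
    rw [thin, pre_inter, tX, tY]
    have e : Ebc \ ((Ebc ∩ Hc) ∩ EA) ∩ (Ecy \ ((Ecy ∩ Hy) ∩ EA)) =
        (Ebc ∩ Ecy) \ ((((Ebc ∩ Ecy) ∩ Hc) ∪ ((Ebc ∩ Ecy) ∩ Hy)) ∩ EA) := by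
      ext ω; simp only [Set.mem_sdiff, Set.mem_inter_iff, Set.mem_union]; tauto
    rw [e]; exact mTwo (Ebc ∩ Ecy) (fun ω hω => hω.2) ⟨(openConn b c)ᶜ ∩ (openConn c y)ᶜ ∩ openConn c h, rfl⟩
      ⟨(openConn b c)ᶜ ∩ (openConn c y)ᶜ ∩ openConn y h, rfl⟩
  have eXYZ : μ.real (X ∩ Y ∩ Z) =
      μ.real (Ebc ∩ Ecy ∩ Eby) - (μ.real (Ebc ∩ Ecy ∩ Eby ∩ Hc) + μ.real (Ebc ∩ Ecy ∩ Eby ∩ Hy)) * μ.real EA := by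
    rw [thin, pre_inter, pre_inter, tX, tY, tZ]
    have e : Ebc \ ((Ebc ∩ Hc) ∩ EA) ∩ (Ecy \ ((Ecy ∩ Hy) ∩ EA)) ∩ Eby =
        (Ebc ∩ Ecy ∩ Eby) \ ((((Ebc ∩ Ecy ∩ Eby) ∩ Hc) ∪ ((Ebc ∩ Ecy ∩ Eby) ∩ Hy)) ∩ EA) := by
      ext ω; simp only [Set.mem_sdiff, Set.mem_inter_iff, Set.mem_union]; tauto
    rw [e]; exact mTwo (Ebc ∩ Ecy ∩ Eby) (fun ω hω => hω.1.2) ⟨(openConn b c)ᶜ ∩ (openConn c y)ᶜ ∩ (openConn b y)ᶜ ∩ openConn c h, rfl⟩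
      ⟨(openConn b c)ᶜ ∩ (openConn c y)ᶜ ∩ (openConn b y)ᶜ ∩ openConn y h, rfl⟩
  have mC : ∀ S H : Set (Set (Sym2 (Fin n))), μ.real (S ∩ Hᶜ) = μ.real S - μ.real (S ∩ H) := by
    intro S H
    have e : S ∩ Hᶜ = S \ (S ∩ H) := by ext ω; simp only [Set.mem_inter_iff, Set.mem_compl_iff, Set.mem_sdiff]; tauto
    rw [e, measureReal_sdiff Set.inter_subset_left (ms _)]
  have m1 : ∀ P : Set (Set (Sym2 (Fin n))), ∀ S : Set (Set (Sym2 (Fin n))), {ω : Set (Sym2 (Fin n)) | ω ∩ ↑D ∈ P} = S → μ.real P = μ.real S := by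
    intro P S hPS; rw [thin, hPS]
  set Sbc : Set (Set (Sym2 (Fin n))) := {ω | ∀ p ∈ [b], ∀ q ∈ [c], ω ∉ openConn p q} with hSbc
  set Scy : Set (Set (Sym2 (Fin n))) := {ω | ∀ p ∈ [c], ∀ q ∈ [y], ω ∉ openConn p q} with hScy
  set Scb : Set (Set (Sym2 (Fin n))) := {ω | ∀ p ∈ [c], ∀ q ∈ [b], ω ∉ openConn p q} with hScb
  set Syb : Set (Set (Sym2 (Fin n))) := {ω | ∀ p ∈ [y], ∀ q ∈ [b], ω ∉ openConn p q} with hSyb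
  set Sbhc : Set (Set (Sym2 (Fin n))) := {ω | ∀ p ∈ [b, h], ∀ q ∈ [c], ω ∉ openConn p q} with hSbhc
  set Schy : Set (Set (Sym2 (Fin n))) := {ω | ∀ p ∈ [c, h], ∀ q ∈ [y], ω ∉ openConn p q} with hSchy
  set Shbc : Set (Set (Sym2 (Fin n))) := {ω | ∀ p ∈ [h, b], ∀ q ∈ [c], ω ∉ openConn p q} with hShbc
  set Shcy : Set (Set (Sym2 (Fin n))) := {ω | ∀ p ∈ [h, c], ∀ q ∈ [y], ω ∉ openConn p q} with hShcy
  have uBC : {ω : Set (Sym2 (Fin n)) | ω ∩ ↑D ∈ Sbc} = Ebc := by rw [hSbc, tS b c hb hc]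
  have uCY : {ω : Set (Sym2 (Fin n)) | ω ∩ ↑D ∈ Scy} = Ecy := by rw [hScy, tS c y hc hy]
  have uCB : {ω : Set (Sym2 (Fin n)) | ω ∩ ↑D ∈ Scb} = Ebc := by rw [hScb, tS c b hc hb, eCB]
  have uYB : {ω : Set (Sym2 (Fin n)) | ω ∩ ↑D ∈ Syb} = Eby := by rw [hSyb, tS y b hy hb, eYB]
  have uBHC : {ω : Set (Sym2 (Fin n)) | ω ∩ ↑D ∈ Sbhc} = Ebc ∩ Hcᶜ := by rw [hSbhc, tSh b c hb hc]
  have uCHY : {ω : Set (Sym2 (Fin n)) | ω ∩ ↑D ∈ Schy} = Ecy ∩ Hyᶜ := by rw [hSchy, tSh c y hc hy]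
  have tSh' : ∀ (x z : Fin n), side x = true → side z = true →
      {ω : Set (Sym2 (Fin n)) | ω ∩ ↑D ∈ {ω : Set (Sym2 (Fin n)) | ∀ p ∈ [h, x], ∀ q ∈ [z], ω ∉ openConn p q}} =
        {ω | ω ∩ ↑F₁ ∈ ((openConn x z)ᶜ : Set (Set (Sym2 (Fin n))))} ∩ {ω | ω ∩ ↑F₁ ∈ (openConn z h : Set (Set (Sym2 (Fin n))))}ᶜ := by
    intro x z hx hz; ext ω
    simp only [Set.mem_setOf_eq, Set.mem_inter_iff, Set.mem_compl_iff, openConn, List.mem_cons, List.mem_nil_iff, or_false,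
      forall_eq_or_imp, forall_eq]
    rw [pl ω x z hx hz, phl ω z hz, SimpleGraph.reachable_comm (u := h)]
    tauto
  have uHBC : {ω : Set (Sym2 (Fin n)) | ω ∩ ↑D ∈ Shbc} = Ebc ∩ Hcᶜ := by rw [hShbc, tSh' b c hb hc]
  have uHCY : {ω : Set (Sym2 (Fin n)) | ω ∩ ↑D ∈ Shcy} = Ecy ∩ Hyᶜ := by rw [hShcy, tSh' c y hc hy]
  rw [sahiE3_def] at h43 h19a h19b h15
  have v43_0 : μ.real (Sbc ∩ Z ∩ Scy) = μ.real (Ebc ∩ Eby ∩ Ecy) := m1 _ _ (by rw [pre_inter, pre_inter, uBC, tZ, uCY])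
  have v43_1 : μ.real (Sbc) = μ.real (Ebc) := m1 _ _ (uBC)
  have v43_2 : μ.real (Z) = μ.real (Eby) := m1 _ _ (tZ)
  have v43_3 : μ.real (Scy) = μ.real (Ecy) := m1 _ _ (uCY)
  have v43_4 : μ.real (Z ∩ Scy) = μ.real (Eby ∩ Ecy) := m1 _ _ (by rw [pre_inter, tZ, uCY])
  have v43_5 : μ.real (Sbc ∩ Scy) = μ.real (Ebc ∩ Ecy) := m1 _ _ (by rw [pre_inter, uBC, uCY])
  have v43_6 : μ.real (Sbc ∩ Z) = μ.real (Ebc ∩ Eby) := m1 _ _ (by rw [pre_inter, uBC, tZ])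
  rw [v43_0, v43_1, v43_2, v43_3, v43_4, v43_5, v43_6] at h43
  have v19a_0 : μ.real (Sbhc ∩ Z ∩ Scy) = μ.real ((Ebc ∩ Hcᶜ) ∩ Eby ∩ Ecy) := m1 _ _ (by rw [pre_inter, pre_inter, uBHC, tZ, uCY])
  have v19a_1 : μ.real (Sbhc) = μ.real ((Ebc ∩ Hcᶜ)) := m1 _ _ (uBHC)
  have v19a_2 : μ.real (Z) = μ.real (Eby) := m1 _ _ (tZ)
  have v19a_3 : μ.real (Scy) = μ.real (Ecy) := m1 _ _ (uCY)
  have v19a_4 : μ.real (Z ∩ Scy) = μ.real (Eby ∩ Ecy) := m1 _ _ (by rw [pre_inter, tZ, uCY])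
  have v19a_5 : μ.real (Sbhc ∩ Scy) = μ.real ((Ebc ∩ Hcᶜ) ∩ Ecy) := m1 _ _ (by rw [pre_inter, uBHC, uCY])
  have v19a_6 : μ.real (Sbhc ∩ Z) = μ.real ((Ebc ∩ Hcᶜ) ∩ Eby) := m1 _ _ (by rw [pre_inter, uBHC, tZ])
  rw [v19a_0, v19a_1, v19a_2, v19a_3, v19a_4, v19a_5, v19a_6] at h19a
  have v19b_0 : μ.real (Schy ∩ Scb ∩ Syb) = μ.real ((Ecy ∩ Hyᶜ) ∩ Ebc ∩ Eby) := m1 _ _ (by rw [pre_inter, pre_inter, uCHY, uCB, uYB])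
  have v19b_1 : μ.real (Schy) = μ.real ((Ecy ∩ Hyᶜ)) := m1 _ _ (uCHY)
  have v19b_2 : μ.real (Scb) = μ.real (Ebc) := m1 _ _ (uCB)
  have v19b_3 : μ.real (Syb) = μ.real (Eby) := m1 _ _ (uYB)
  have v19b_4 : μ.real (Scb ∩ Syb) = μ.real (Ebc ∩ Eby) := m1 _ _ (by rw [pre_inter, uCB, uYB])
  have v19b_5 : μ.real (Schy ∩ Syb) = μ.real ((Ecy ∩ Hyᶜ) ∩ Eby) := m1 _ _ (by rw [pre_inter, uCHY, uYB])
  have v19b_6 : μ.real (Schy ∩ Scb) = μ.real ((Ecy ∩ Hyᶜ) ∩ Ebc) := m1 _ _ (by rw [pre_inter, uCHY, uCB])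
  rw [v19b_0, v19b_1, v19b_2, v19b_3, v19b_4, v19b_5, v19b_6] at h19b
  have v15_0 : μ.real (Shbc ∩ Shcy ∩ Z) = μ.real ((Ebc ∩ Hcᶜ) ∩ (Ecy ∩ Hyᶜ) ∩ Eby) := m1 _ _ (by rw [pre_inter, pre_inter, uHBC, uHCY, tZ])
  have v15_1 : μ.real (Shbc) = μ.real ((Ebc ∩ Hcᶜ)) := m1 _ _ (uHBC)
  have v15_2 : μ.real (Shcy) = μ.real ((Ecy ∩ Hyᶜ)) := m1 _ _ (uHCY)
  have v15_3 : μ.real (Z) = μ.real (Eby) := m1 _ _ (tZ)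
  have v15_4 : μ.real (Shcy ∩ Z) = μ.real ((Ecy ∩ Hyᶜ) ∩ Eby) := m1 _ _ (by rw [pre_inter, uHCY, tZ])
  have v15_5 : μ.real (Shbc ∩ Z) = μ.real ((Ebc ∩ Hcᶜ) ∩ Eby) := m1 _ _ (by rw [pre_inter, uHBC, tZ])
  have v15_6 : μ.real (Shbc ∩ Shcy) = μ.real ((Ebc ∩ Hcᶜ) ∩ (Ecy ∩ Hyᶜ)) := m1 _ _ (by rw [pre_inter, uHBC, uHCY])
  rw [v15_0, v15_1, v15_2, v15_3, v15_4, v15_5, v15_6] at h15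
  have w0 : μ.real ((Ebc ∩ Hcᶜ) ∩ Eby ∩ Ecy) = μ.real ((Ebc ∩ Eby ∩ Ecy) ∩ Hcᶜ) := by
    congr 1; ext ω; simp only [Set.mem_inter_iff, Set.mem_compl_iff]; tauto
  have w1 : μ.real ((Ebc ∩ Hcᶜ) ∩ Ecy) = μ.real ((Ebc ∩ Ecy) ∩ Hcᶜ) := by
    congr 1; ext ω; simp only [Set.mem_inter_iff, Set.mem_compl_iff]; tauto
  have w2 : μ.real ((Ebc ∩ Hcᶜ) ∩ Eby) = μ.real ((Ebc ∩ Eby) ∩ Hcᶜ) := by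
    congr 1; ext ω; simp only [Set.mem_inter_iff, Set.mem_compl_iff]; tauto
  have w3 : μ.real ((Ecy ∩ Hyᶜ) ∩ Ebc ∩ Eby) = μ.real ((Ebc ∩ Ecy ∩ Eby) ∩ Hyᶜ) := by
    congr 1; ext ω; simp only [Set.mem_inter_iff, Set.mem_compl_iff]; tauto
  have w4 : μ.real ((Ecy ∩ Hyᶜ) ∩ Eby) = μ.real ((Ecy ∩ Eby) ∩ Hyᶜ) := by
    congr 1; ext ω; simp only [Set.mem_inter_iff, Set.mem_compl_iff]; tauto
  have w5 : μ.real ((Ecy ∩ Hyᶜ) ∩ Ebc) = μ.real ((Ebc ∩ Ecy) ∩ Hyᶜ) := by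
    congr 1; ext ω; simp only [Set.mem_inter_iff, Set.mem_compl_iff]; tauto
  have dj2 : ∀ S : Set (Set (Sym2 (Fin n))), S ⊆ Ecy →
      μ.real (S ∩ Hcᶜ ∩ Hyᶜ) = μ.real S - (μ.real (S ∩ Hc) + μ.real (S ∩ Hy)) := by
    intro S hS
    have e : S ∩ Hcᶜ ∩ Hyᶜ = S \ ((S ∩ Hc) ∪ (S ∩ Hy)) := by
      ext ω; simp only [Set.mem_inter_iff, Set.mem_compl_iff, Set.mem_sdiff, Set.mem_union]; tauto
    have hd : Disjoint (S ∩ Hc) (S ∩ Hy) := Set.disjoint_left.2 fun ω h1 h2 => djH ω (hS h1.1) h1.2 h2.2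
    rw [e, measureReal_sdiff (fun ω hω => by rcases hω with h1 | h2 <;> [exact h1.1; exact h2.1]) (ms _), measureReal_union hd (ms _)]
  have x1 : μ.real ((Ebc ∩ Hcᶜ) ∩ (Ecy ∩ Hyᶜ) ∩ Eby) = μ.real (Ebc ∩ Ecy ∩ Eby) -
      (μ.real (Ebc ∩ Ecy ∩ Eby ∩ Hc) + μ.real (Ebc ∩ Ecy ∩ Eby ∩ Hy)) := by
    have e : (Ebc ∩ Hcᶜ) ∩ (Ecy ∩ Hyᶜ) ∩ Eby = (Ebc ∩ Ecy ∩ Eby) ∩ Hcᶜ ∩ Hyᶜ := by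
      ext ω; simp only [Set.mem_inter_iff, Set.mem_compl_iff]; tauto
    rw [e]; exact dj2 _ (fun ω hω => hω.1.2)
  have x2 : μ.real ((Ebc ∩ Hcᶜ) ∩ (Ecy ∩ Hyᶜ)) = μ.real (Ebc ∩ Ecy) - (μ.real (Ebc ∩ Ecy ∩ Hc) + μ.real (Ebc ∩ Ecy ∩ Hy)) := by
    have e : (Ebc ∩ Hcᶜ) ∩ (Ecy ∩ Hyᶜ) = (Ebc ∩ Ecy) ∩ Hcᶜ ∩ Hyᶜ := by
      ext ω; simp only [Set.mem_inter_iff, Set.mem_compl_iff]; tauto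
    rw [e]; exact dj2 _ (fun ω hω => hω.2)
  have s1 : μ.real (Eby ∩ Ecy) = μ.real (Ecy ∩ Eby) := by rw [Set.inter_comm]
  have s2 : μ.real (Ebc ∩ Eby ∩ Ecy) = μ.real (Ebc ∩ Ecy ∩ Eby) := by
    congr 1; ext ω; simp only [Set.mem_inter_iff]; tauto
  have s3 : μ.real (Ebc ∩ Eby ∩ Ecy ∩ Hc) = μ.real (Ebc ∩ Ecy ∩ Eby ∩ Hc) := by
    congr 1; ext ω; simp only [Set.mem_inter_iff]; tauto
  have lA1 : μ.real ((Ebc ∩ Hcᶜ) ∩ Eby ∩ Ecy) = μ.real (Ebc ∩ Ecy ∩ Eby) - μ.real (Ebc ∩ Ecy ∩ Eby ∩ Hc) := by rw [w0, mC, s2, s3]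
  have lA2 : μ.real (Ebc ∩ Hcᶜ) = μ.real Ebc - μ.real (Ebc ∩ Hc) := mC _ _
  have lA3 : μ.real ((Ebc ∩ Hcᶜ) ∩ Ecy) = μ.real (Ebc ∩ Ecy) - μ.real (Ebc ∩ Ecy ∩ Hc) := by rw [w1, mC]
  have lA4 : μ.real ((Ebc ∩ Hcᶜ) ∩ Eby) = μ.real (Ebc ∩ Eby) - μ.real (Ebc ∩ Eby ∩ Hc) := by rw [w2, mC]
  have lB1 : μ.real ((Ecy ∩ Hyᶜ) ∩ Ebc ∩ Eby) = μ.real (Ebc ∩ Ecy ∩ Eby) - μ.real (Ebc ∩ Ecy ∩ Eby ∩ Hy) := by rw [w3, mC]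
  have lB2 : μ.real (Ecy ∩ Hyᶜ) = μ.real Ecy - μ.real (Ecy ∩ Hy) := mC _ _
  have lB3 : μ.real ((Ecy ∩ Hyᶜ) ∩ Eby) = μ.real (Ecy ∩ Eby) - μ.real (Ecy ∩ Eby ∩ Hy) := by rw [w4, mC]
  have lB4 : μ.real ((Ecy ∩ Hyᶜ) ∩ Ebc) = μ.real (Ebc ∩ Ecy) - μ.real (Ebc ∩ Ecy ∩ Hy) := by rw [w5, mC]
  rw [s1] at h43 h19a
  rw [s2] at h43
  have hρ0 : 0 ≤ μ.real EA := measureReal_nonneg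
  have hρ1 : μ.real EA ≤ 1 := (measureReal_mono (Set.subset_univ EA)).trans (le_of_eq (by simp [hμ]))
  rw [sahiE3_def, eXYZ, eX, eY, eZ, eYZ, eXZ, eXY]
  exact row15_threeOneCutA_ineq (μ.real EA) (μ.real Ebc) (μ.real Ecy) (μ.real Eby) (μ.real (Ebc ∩ Hc)) (μ.real (Ecy ∩ Hy))
    (μ.real (Ebc ∩ Ecy)) (μ.real (Ebc ∩ Eby)) (μ.real (Ecy ∩ Eby)) (μ.real (Ebc ∩ Ecy ∩ Eby)) (μ.real (Ebc ∩ Ecy ∩ Hc))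
    (μ.real (Ebc ∩ Ecy ∩ Hy)) (μ.real (Ebc ∩ Eby ∩ Hc)) (μ.real (Ecy ∩ Eby ∩ Hy)) (μ.real (Ebc ∩ Ecy ∩ Eby ∩ Hc))
    (μ.real (Ebc ∩ Ecy ∩ Eby ∩ Hy)) _ _ _ _ _ _ _ _ _ _ hρ0 hρ1 lA1 lA2 lA3 lA4 lB1 lB2 lB3 lB4 x1 x2 h43 h19a h19b h15

end Summit.CriticalPhenomena.PercolationContinuityZ3.Theorems.FrontierDecRows
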